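import Mathlib.Logic.Relation
import Literature.Computability.Complexity.TwoColouringScan
import HarnessLib

/-!
# Correctness of the polynomial 2-colouring scan

Support file for the discharge of `DyerEtAl2003.BISAPReducibleDownsets` (`BISDownsets.lean`,
`BISDownsetsProofs.lean`): the functional program `TwoColouring.colouring` of
`TwoColouringScan.lean` (seed `0, 1, …, n - 1` in turn, closing under `n` propagation rounds after
each seed) 2-colours every 2-colourable graph.

* Invariants: `Closed` (the coloured vertices are closed under adjacency), `EdgeConst flip`
  (`flip` is constant along edges), `Agrees side flip c` (every coloured vertex carries the colour
  `side ⊕ flip`), `Small` (colours `≤ 2`);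
* `agrees_propagate` (a round keeps the invariant), `agrees_seed` (in a CLOSED colouring a seed is
  planted in a blank component, `col_eq_two_of_reach`, and the flip is re-chosen there),
  `closed_close` (`n` rounds close a colouring: a round that does not close it colours a new vertex,
  `closed_or_le_card_iterate`);
* **`proper_colouring_of_colorable`**: if `graph n v` is 2-colourable then `colouring n v` passes the
  test `proper`; `side_of_proper`: a proper colouring gives a bipartition side `zeroSide`.

(Breadth-first 2-colouring is textbook, e.g. Kleinberg–Tardos, *Algorithm Design*, 2005, §3.4.)

## References

* M. Dyer, L. A. Goldberg, C. Greenhill, M. Jerrum, *The relative complexity of approximate counting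
  problems*, Algorithmica 38 (2003) 471–500, Theorem 5 [DyerEtAl2003].
-/

namespace Literature.Computability.Complexity

namespace TwoColouring

/-! ### Correctness of the scan: invariants -/

section Correctness

variable {n : ℕ} {v : List Bool}

/-- The coloured vertices are closed under adjacency. [folklore] -/
def Closed (n : ℕ) (v : List Bool) (c : List ℕ) : Prop :=
  ∀ i j, i < n → j < n → adj n v i j = true → col c i ≠ 2 → col c j ≠ 2

/-- `flip` is constant along edges. [folklore] -/
def EdgeConst (n : ℕ) (v : List Bool) (flip : ℕ → Bool) : Prop :=
  ∀ i j, i < n → j < n → adj n v i j = true → flip i = flip j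

/-- `side` is a side of a bipartition: adjacent vertices lie on different sides. [folklore] -/
def IsSide (n : ℕ) (v : List Bool) (side : ℕ → Bool) : Prop :=
  ∀ i j, i < n → j < n → adj n v i j = true → side i ≠ side j

/-- The coloured vertices carry the colour `side ⊕ flip`. [folklore] -/
def Agrees (n : ℕ) (side flip : ℕ → Bool) (c : List ℕ) : Prop :=
  ∀ i, i < n → col c i ≠ 2 → col c i = (side i ^^ flip i).toNat

/-- All colours are `≤ 2`. [folklore] -/
def Small (n : ℕ) (c : List ℕ) : Prop := ∀ i, i < n → col c i ≤ 2

/-- A colouring satisfying the invariant has colours `≤ 2`. [folklore] -/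
theorem small_of_agrees {side flip : ℕ → Bool} {c : List ℕ} (h : Agrees n side flip c) : Small n c := by
  intro i hi
  by_cases h2 : col c i = 2
  · omega
  · rw [h i hi h2]; exact (Bool.toNat_le _).trans one_le_two

/-- `(a ⊕ b) = 0 ↔ a = b`. [folklore] -/
theorem toNat_xor_eq_zero_iff (a b : Bool) : (a ^^ b).toNat = 0 ↔ a = b := by
  cases a <;> cases b <;> simp

/-- `(a ⊕ b) = 1 ↔ a ≠ b`. [folklore] -/
theorem toNat_xor_eq_one_iff (a b : Bool) : (a ^^ b).toNat = 1 ↔ a ≠ b := by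
  cases a <;> cases b <;> simp

/-- **Propagation keeps the invariant** (with the same flip). [folklore] -/
theorem agrees_propagate {side flip : ℕ → Bool} {c : List ℕ} (hs : IsSide n v side)
    (hf : EdgeConst n v flip) (h : Agrees n side flip c) : Agrees n side flip (propagate n v c) := by
  intro i hi hne
  rw [col_propagate v c hi] at hne ⊢
  unfold recolour at hne ⊢
  by_cases h2 : (col c i == 2) = true
  · rw [if_pos h2] at hne ⊢
    by_cases h0 : hasNbr n v c i 0 = true
    · rw [if_pos h0]
      obtain ⟨j, hj, hadj, hcj⟩ := hasNbr_eq_true.1 h0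
      have hj' := h j hj (by omega)
      rw [hcj, eq_comm, toNat_xor_eq_zero_iff] at hj'
      rw [eq_comm, toNat_xor_eq_one_iff, hf i j hi hj hadj, ← hj']
      exact hs i j hi hj hadj
    · rw [if_neg h0] at hne ⊢
      by_cases h1 : hasNbr n v c i 1 = true
      · rw [if_pos h1]
        obtain ⟨j, hj, hadj, hcj⟩ := hasNbr_eq_true.1 h1
        have hj' := h j hj (by omega)
        rw [hcj, eq_comm, toNat_xor_eq_one_iff] at hj'
        rw [eq_comm, toNat_xor_eq_zero_iff, hf i j hi hj hadj]
        have := hs i j hi hj hadj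
        revert this hj'
        cases side i <;> cases side j <;> cases flip j <;> simp
      · rw [if_neg h1] at hne
        exact absurd rfl hne
  · rw [if_neg h2] at hne ⊢
    exact h i hi hne

/-- Reachability along edges inside `[0, n)`. [folklore] -/
def Reach (n : ℕ) (v : List Bool) : ℕ → ℕ → Prop :=
  Relation.ReflTransGen fun a b => a < n ∧ b < n ∧ adj n v a b = true

/-- Adjacent vertices are reachable together. [folklore] -/
theorem reach_adj {s i j : ℕ} (hi : i < n) (hj : j < n) (hadj : adj n v i j = true) :
    Reach n v s i ↔ Reach n v s j :=
  ⟨fun h => h.tail ⟨hi, hj, hadj⟩, fun h => h.tail ⟨hj, hi, by rwa [adj_comm]⟩⟩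

/-- In an adjacency-closed colouring the component of a blank vertex is blank. [folklore] -/
theorem col_eq_two_of_reach {c : List ℕ} (hc : Closed n v c) {s i : ℕ} (hs : col c s = 2)
    (hr : Reach n v s i) : col c i = 2 := by
  induction hr with
  | refl => exact hs
  | tail _ hab ih =>
    obtain ⟨ha, hb, hadj⟩ := hab
    by_contra hne
    exact hc _ _ hb ha (by rwa [adj_comm]) hne ih

/-- Seeding a coloured vertex changes nothing. [folklore] -/
theorem col_seed_of_ne_two {s i : ℕ} {c : List ℕ} (hi : i < n) (hs : col c s ≠ 2) :
    col (seed n s c) i = col c i := by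
  rw [col_seed c hi, if_neg]
  intro h
  rw [Bool.and_eq_true, beq_iff_eq, beq_iff_eq] at h
  exact hs (h.1 ▸ h.2)

/-- **Seeding keeps the invariant** (with a new flip on the — blank — component of the seed), in an
adjacency-closed colouring. [folklore] -/
theorem agrees_seed {side flip : ℕ → Bool} {c : List ℕ}
    (hf : EdgeConst n v flip) (h : Agrees n side flip c) (hc : Closed n v c) (s : ℕ) :
    ∃ flip' : ℕ → Bool, EdgeConst n v flip' ∧ Agrees n side flip' (seed n s c) := by
  classical
  by_cases hs2 : col c s = 2
  · refine ⟨fun i => if Reach n v s i then side s else flip i, fun i j hi hj hadj => ?_, fun i hi hne => ?_⟩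
    · simp only [reach_adj hi hj hadj, hf i j hi hj hadj]
    · rw [col_seed c hi] at hne ⊢
      by_cases hcase : ((i == s) && (col c i == 2)) = true
      · rw [Bool.and_eq_true, beq_iff_eq] at hcase
        rw [if_pos (by simpa using hcase), hcase.1]
        simp [Reach, Relation.ReflTransGen.refl]
      · rw [if_neg hcase] at hne ⊢
        have hnr : ¬ Reach n v s i := fun hr => hne (col_eq_two_of_reach hc hs2 hr)
        simp only [hnr, if_false]
        exact h i hi hne
  · refine ⟨flip, hf, fun i hi hne => ?_⟩
    rw [col_seed_of_ne_two hi hs2] at hne ⊢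
    exact h i hi hne

/-! ### Correctness of the scan: `n` propagation rounds close a colouring -/

/-- Coloured vertices keep their colour under propagation. [folklore] -/
theorem col_propagate_of_ne_two {i : ℕ} {c : List ℕ} (hi : i < n) (h : col c i ≠ 2) :
    col (propagate n v c) i = col c i := by
  rw [col_propagate v c hi, recolour, if_neg]
  simpa using h

/-- Propagation keeps colours `≤ 2`. [folklore] -/
theorem small_propagate {c : List ℕ} (h : Small n c) : Small n (propagate n v c) := by
  intro i hi
  rw [col_propagate v c hi, recolour]
  split_ifs
  · omega
  · omega
  · exact le_rfl
  · exact h i hi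

/-- Propagation does not change an adjacency-closed colouring. [folklore] -/
theorem col_propagate_of_closed {c : List ℕ} (hc : Closed n v c) {i : ℕ} (hi : i < n) :
    col (propagate n v c) i = col c i := by
  by_cases h2 : col c i = 2
  · rw [col_propagate v c hi, recolour, if_pos (by simpa using h2)]
    have hno : ∀ a, a ≠ 2 → hasNbr n v c i a = false := by
      intro a ha
      rw [Bool.eq_false_iff]
      intro hh
      obtain ⟨j, hj, hadj, hcj⟩ := hasNbr_eq_true.1 hh
      exact hc j i hj hi (by rwa [adj_comm]) (by omega) h2
    rw [hno 0 (by omega), hno 1 (by omega)]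
    simpa using h2.symm
  · exact col_propagate_of_ne_two hi h2

/-- An adjacency-closed colouring stays closed under propagation. [folklore] -/
theorem closed_propagate_of_closed {c : List ℕ} (hc : Closed n v c) : Closed n v (propagate n v c) := by
  intro i j hi hj hadj
  rw [col_propagate_of_closed hc hi, col_propagate_of_closed hc hj]
  exact hc i j hi hj hadj

/-- If the colouring is not closed, a round colours a new vertex. [folklore] -/
theorem exists_new_colour {c : List ℕ} (hsm : Small n c) (hnc : ¬ Closed n v c) :
    ∃ j < n, col c j = 2 ∧ col (propagate n v c) j ≠ 2 := by
  simp only [Closed, not_forall, exists_prop, not_not] at hnc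
  obtain ⟨i, j, hi, hj, hadj, hci, hcj⟩ := hnc
  refine ⟨j, hj, hcj, ?_⟩
  rw [col_propagate v c hj, recolour, if_pos (by simpa using hcj)]
  have hi2 := hsm i hi
  split_ifs with h0 h1
  · omega
  · omega
  · exfalso
    rw [adj_comm] at hadj
    rcases Nat.lt_or_ge (col c i) 1 with hlt | hge
    · exact h0 (hasNbr_eq_true.2 ⟨i, hi, hadj, by omega⟩)
    · exact h1 (hasNbr_eq_true.2 ⟨i, hi, hadj, by omega⟩)

/-- The number of coloured vertices. [folklore] -/
def coloured (n : ℕ) (c : List ℕ) : Finset ℕ := (Finset.range n).filter fun i => col c i ≠ 2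

/-- The coloured set grows under propagation. [folklore] -/
theorem coloured_subset_propagate (c : List ℕ) : coloured n c ⊆ coloured n (propagate n v c) := by
  intro i hi
  simp only [coloured, Finset.mem_filter, Finset.mem_range] at hi ⊢
  exact ⟨hi.1, by rw [col_propagate_of_ne_two hi.1 hi.2]; exact hi.2⟩

/-- At most `n` vertices are coloured. [folklore] -/
theorem card_coloured_le (c : List ℕ) : (coloured n c).card ≤ n :=
  (Finset.card_filter_le _ _).trans (Finset.card_range n).le

/-- After `k` rounds the colouring is closed or at least `k` vertices are coloured (each round that
does not close the colouring colours a new vertex). [folklore] -/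
theorem closed_or_le_card_iterate {c : List ℕ} (hsm : Small n c) :
    ∀ k : ℕ, Small n ((propagate n v)^[k] c) ∧
      (Closed n v ((propagate n v)^[k] c) ∨ k ≤ (coloured n ((propagate n v)^[k] c)).card)
  | 0 => ⟨hsm, Or.inr (Nat.zero_le _)⟩
  | k + 1 => by
    obtain ⟨hsk, hk⟩ := closed_or_le_card_iterate hsm k
    rw [Function.iterate_succ_apply']
    refine ⟨small_propagate hsk, ?_⟩
    by_cases hcl : Closed n v ((propagate n v)^[k] c)
    · exact Or.inl (closed_propagate_of_closed hcl)
    · right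
      have hk' : k ≤ (coloured n ((propagate n v)^[k] c)).card := hk.resolve_left hcl
      obtain ⟨j, hj, hcj, hpj⟩ := exists_new_colour hsk hcl
      have hss : coloured n ((propagate n v)^[k] c) ⊂ coloured n (propagate n v ((propagate n v)^[k] c)) := by
        refine Finset.ssubset_iff_subset_ne.2 ⟨coloured_subset_propagate _, fun heq => ?_⟩
        have hmem : j ∈ coloured n (propagate n v ((propagate n v)^[k] c)) := by
          simp [coloured, hj, hpj]
        rw [← heq] at hmem
        simp [coloured, hcj] at hmem
      have := Finset.card_lt_card hss
      omega

/-- **`n` rounds close a colouring.** [folklore] -/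
theorem closed_close {c : List ℕ} (hsm : Small n c) : Closed n v (close n v c) := by
  rw [close_eq_iterate]
  obtain ⟨-, h | h⟩ := closed_or_le_card_iterate (v := v) hsm n
  · exact h
  · -- every vertex is coloured
    intro i j hi hj _ _ hcj
    have hsub : coloured n ((propagate n v)^[n] c) ⊆ (Finset.range n).erase j := by
      intro x hx
      simp only [coloured, Finset.mem_filter, Finset.mem_range] at hx
      exact Finset.mem_erase.2 ⟨fun hxj => hx.2 (hxj ▸ hcj), Finset.mem_range.2 hx.1⟩
    have := Finset.card_le_card hsub
    rw [Finset.card_erase_of_mem (Finset.mem_range.2 hj), Finset.card_range] at this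
    omega

/-- Iterated propagation keeps the invariant. [folklore] -/
theorem agrees_iterate {side flip : ℕ → Bool} {c : List ℕ} (hs : IsSide n v side)
    (hf : EdgeConst n v flip) (h : Agrees n side flip c) :
    ∀ k, Agrees n side flip ((propagate n v)^[k] c)
  | 0 => h
  | k + 1 => by
    rw [Function.iterate_succ_apply']
    exact agrees_propagate hs hf (agrees_iterate hs hf h k)

/-- Coloured vertices keep their colour under iterated propagation. [folklore] -/
theorem col_iterate_of_ne_two {i : ℕ} {c : List ℕ} (hi : i < n) (h : col c i ≠ 2) :
    ∀ k, col ((propagate n v)^[k] c) i = col c i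
  | 0 => rfl
  | k + 1 => by
    rw [Function.iterate_succ_apply', col_propagate_of_ne_two hi (by rw [col_iterate_of_ne_two hi h k]; exact h),
      col_iterate_of_ne_two hi h k]

/-- Coloured vertices keep their colour under `close`. [folklore] -/
theorem col_close_of_ne_two {i : ℕ} {c : List ℕ} (hi : i < n) (h : col c i ≠ 2) :
    col (close n v c) i = col c i := by
  rw [close_eq_iterate]; exact col_iterate_of_ne_two hi h n

/-! ### Correctness of the scan: the main theorem -/

/-- The loop invariant of the scan. [folklore] -/
def Inv (n : ℕ) (v : List Bool) (side : ℕ → Bool) (c : List ℕ) : Prop :=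
  (∃ flip, EdgeConst n v flip ∧ Agrees n side flip c) ∧ Closed n v c

/-- The blank colouring satisfies the loop invariant. [folklore] -/
theorem inv_blank (side : ℕ → Bool) : Inv n v side (blank n) :=
  ⟨⟨fun _ => false, fun _ _ _ _ _ => rfl, fun _ hi hne => absurd (col_blank hi) hne⟩,
    fun _ _ hi _ _ hne => absurd (col_blank hi) hne⟩

/-- One step of the scan (seed, then close) keeps the loop invariant. [folklore] -/
theorem inv_step {side : ℕ → Bool} (hs : IsSide n v side) {c : List ℕ} (h : Inv n v side c) (s : ℕ) :
    Inv n v side (close n v (seed n s c)) := by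
  obtain ⟨⟨flip, hf, ha⟩, hc⟩ := h
  obtain ⟨flip', hf', ha'⟩ := agrees_seed hf ha hc s
  refine ⟨⟨flip', hf', ?_⟩, closed_close (small_of_agrees ha')⟩
  rw [close_eq_iterate]
  exact agrees_iterate hs hf' ha' _

/-- The scan keeps the loop invariant, for any list of seeds. [folklore] -/
theorem inv_foldl {side : ℕ → Bool} (hs : IsSide n v side) :
    ∀ (l : List ℕ) {c : List ℕ}, Inv n v side c →
      Inv n v side (l.foldl (fun c s => close n v (seed n s c)) c)
  | [], _, h => h
  | s :: l, _, h => inv_foldl hs l (inv_step hs h s)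

/-- Coloured vertices keep their colour along the scan. [folklore] -/
theorem col_foldl_of_ne_two {i : ℕ} (hi : i < n) :
    ∀ (l : List ℕ) {c : List ℕ}, col c i ≠ 2 →
      col (l.foldl (fun c s => close n v (seed n s c)) c) i = col c i
  | [], _, _ => rfl
  | s :: l, c, h => by
    have h1 : col (close n v (seed n s c)) i = col c i := by
      have h2 : col (seed n s c) i = col c i := by
        rw [col_seed c hi, if_neg]
        simpa using fun _ => h
      rw [col_close_of_ne_two hi (by rw [h2]; exact h), h2]
    rw [List.foldl_cons, col_foldl_of_ne_two hi l (by rw [h1]; exact h), h1]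

/-- A seeded vertex is coloured at the end of the scan. [folklore] -/
theorem col_foldl_ne_two {s : ℕ} (hs : s < n) :
    ∀ (l : List ℕ) (c : List ℕ), s ∈ l →
      col (l.foldl (fun c s => close n v (seed n s c)) c) s ≠ 2
  | [], _, h => absurd h List.not_mem_nil
  | a :: l, c, h => by
    rw [List.foldl_cons]
    rcases List.mem_cons.1 h with rfl | h
    · have h1 : col (close n v (seed n s c)) s ≠ 2 := by
        have h2 : col (seed n s c) s ≠ 2 := by
          rw [col_seed c hs]
          split_ifs with hh
          · omega
          · simpa using hh
        rwa [col_close_of_ne_two hs h2]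
      rwa [col_foldl_of_ne_two hs l h1]
    · exact col_foldl_ne_two hs l _ h

/-- **The scan 2-colours every 2-colourable graph**: if `graph n v` is 2-colourable then
`colouring n v` passes the test `proper` (every edge has exactly one end of colour `0`).
[cite: DyerEtAl2003, Theorem 5 (the bipartition behind `#BIS ≤_AP #DOWNSETS`)] -/
theorem proper_colouring_of_colorable (h : (graph n v).Colorable 2) : proper n v (colouring n v) = true := by
  classical
  obtain ⟨C⟩ := h
  -- the side of a genuine 2-colouring
  set side : ℕ → Bool := fun i => if hi : i < n then decide (C ⟨i, hi⟩ = 0) else false with hside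
  have hs : IsSide n v side := by
    intro i j hi hj hadj
    have hv := C.valid ((graph_adj n v ⟨i, hi⟩ ⟨j, hj⟩).2 hadj)
    simp only [hside, hi, hj, dite_true, ne_eq, decide_eq_decide]
    revert hv
    generalize C ⟨i, hi⟩ = a
    generalize C ⟨j, hj⟩ = b
    revert a b
    decide
  obtain ⟨⟨flip, hf, ha⟩, -⟩ := inv_foldl hs (List.range n) (inv_blank side)
  have hall : ∀ i < n, col (colouring n v) i ≠ 2 := fun i hi =>
    col_foldl_ne_two hi (List.range n) (blank n) (List.mem_range.2 hi)
  rw [proper, List.all_eq_true]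
  intro i hi
  rw [List.all_eq_true]
  intro j hj
  rw [List.mem_range] at hi hj
  cases hadj : adj n v i j
  · rfl
  · have hci := ha i hi (hall i hi)
    have hcj := ha j hj (hall j hj)
    change col (colouring n v) i = _ at hci
    change col (colouring n v) j = _ at hcj
    rw [Bool.not_true, Bool.false_or, hci, hcj, hf i j hi hj hadj]
    have := hs i j hi hj hadj
    revert this
    cases side i <;> cases side j <;> cases flip j <;> simp

/-- The colour-`0` class of a colour list, as a set of vertices of `Fin n`. [folklore] -/
def zeroSide (n : ℕ) (c : List ℕ) : Finset (Fin n) := Finset.univ.filter fun i => col c i.val = 0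

/-- **A proper colouring gives a side**: every edge has exactly one end in the colour-`0` class.
[folklore] -/
theorem side_of_proper {c : List ℕ} (h : proper n v c = true) :
    ∀ ⦃i j : Fin n⦄, (graph n v).Adj i j → (i ∈ zeroSide n c ↔ j ∉ zeroSide n c) := by
  intro i j hadj
  rw [graph_adj] at hadj
  rw [proper, List.all_eq_true] at h
  have h1 := h i.val (List.mem_range.2 i.isLt)
  rw [List.all_eq_true] at h1
  have h2 := h1 j.val (List.mem_range.2 j.isLt)
  rw [hadj] at h2
  simp only [zeroSide, Finset.mem_filter, Finset.mem_univ, true_and]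
  revert h2
  cases hci : (col c i.val == 0) <;> cases hcj : (col c j.val == 0) <;> simp_all

end Correctness

end TwoColouring

end Literature.Computability.Complexity
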